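import Summits.KontsevichZagierPeriods.Zeta5Search.Barrier.ConeGammaCuspPeriodWallGauge

/-!
# ζ(5) search — BARRIER: FINITE CONE CERTIFICATES — no-ascent cones and ascent cones from finitely many checks, ANY type

HONEST FRAMING (cell `pub-zeta5`): systematic search; no irrationality claim unless kernel-certified. MODEL objects
under Brown–Zudilin's (28)+(30) accounting ([BZ22] = arXiv:2210.03391; (28) observed, not proved); nothing here is a
statement about `ζ(5)`, any `γ` of record, the cone's supremum (C2 OPEN) or the value / sign of the cusp slope at a named
direction; NO certificate instance is asserted for any named direction — at record/41, flag/60, argmax-120 and t*/480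
ASCENT DIRECTIONS EXIST (DATA of the cell: P2 g11's ascent census A4, relay 268), so «σ ≤ 0 in every direction» is false
there and nothing below is instantiated there; S-E stays CONJECTURED; records in print UNMOVED. Prover P2 g32, item
«THE WALL-WEIGHTED GAUGE» (INBOX 2026-08-27), file (3): the SCHEMA that turns file (2)'s bounds into finite certificates.

With the data of `cuspSlope_le_greedy_add_wallGauge` (generic reference `δ₀`, per-wall defect bounds `Λ ≥ 0`) write
`M⁺_{δ₀}(δ) = G_{δ₀}(δ) + Σ_{ρ₀ k < ρ₀ l} Λ k l · max(r_k(δ) − r_l(δ), 0)` (the MAJORANT, `σ ≤ M⁺`) and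
`M⁻_{δ₀}(δ) = G_{δ₀}(δ) − Σ_{ρ₀ k < ρ₀ l} Λ k l · max(r_k(δ) − r_l(δ), 0)` (the MINORANT, `M⁻ ≤ σ`). The rates are linear in
`δ` (`rate_sum_smul`), so `G_{δ₀}` is linear (`greedyFun_sum_smul`) and the gauge term is subadditive and positively
homogeneous (`wallGauge_smul`, `wallGauge_add_le`, `wallGauge_sum_smul_le` via the generic `subadd_homog_sum_le`). Hence:
* **`cuspSlope_nonpos_on_cone_of_generators`** — if `M⁺_{δ₀}(g_j) ≤ 0` at finitely many generators `g_j` (`j ∈ s`), then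
  `σ(Σ_j t_j g_j) ≤ 0` for all `t ≥ 0`: a NO-ASCENT CONE certified by `#s` rational checks;
* **`cuspSlope_pos_on_cone_of_generators`** — if `M⁻_{δ₀}(g_j) > 0` at the generators, then `σ(Σ_j t_j g_j) > 0` for all
  `t ≥ 0` with some `t_j > 0`: an ASCENT CONE;
* **`cuspSlope_nonpos_of_cone_covering`** — finitely many (reference, generator family) pairs, each certified as above,
  whose cones cover the displacements certify `σ ≤ 0` in EVERY direction (the any-type replacement of P2 g31's hull
  certificate; together with `exists_generic_wallBound_eq_cuspSlope` of file (2): pointwise, a certifying reference with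
  zero slack always exists where `σ ≤ 0`);
* `majorant_add_smul_sParam` — `M⁺_{δ₀}(δ + u·s(a)) = M⁺_{δ₀}(δ)`: the certificates live on `ℝ⁸ / ℝ·s(a)` (all rates
  shift by `u`, the weights sum to zero, P2 g31's `period_greedy_sum_eq_zero`).
DESK (DATA, `HOME/pub-zeta5-p2/g32/alg/wallgauge.py` (W4)/(W5), sampled per-wall bounds = lower estimates): one reference
certifies a no-ascent sup-norm neighbourhood of relative radius median 0.49 / 0.62 / 0.67 / 3.0 (record / flag / argmax /
t*; P2 g31's global gauge: 0.13 / 0.15 / 0.12 / 0.21); around the one ascent reference met at record an ascent cone of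
radius 0.073. NOT here: any certificate at a named direction; the covering computation; `γ`, C2, S-E, `ζ(5)`.
-/

noncomputable section

open Set MeasureTheory Finset
open scoped Topology

namespace Summit.KontsevichZagierPeriods.Zeta5Search.Barrier.ConeGamma

/-! ### Linearity of the rates and of a chamber functional -/

/-- The rates are linear: `r_k(Σ_j t_j • g_j) = Σ_j t_j · r_k(g_j)`. -/
theorem rate_sum_smul (a : Dir) {ι : Type*} (s : Finset ι) (t : ι → ℝ) (g : ι → Fin 8 → ℝ) (k : Fin 28) :
    phiForm (∑ j ∈ s, t j • g j) k / h28 a k = ∑ j ∈ s, t j * (phiForm (g j) k / h28 a k) := by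
  rw [phiForm_sum, Finset.sum_div]
  exact Finset.sum_congr rfl fun j _ => by rw [phiForm_smul]; ring

/-- A weighted rate functional is linear: `Σ_k w_k r_k(Σ_j t_j • g_j) = Σ_j t_j · Σ_k w_k r_k(g_j)`. -/
theorem greedyFun_sum_smul (a : Dir) (w : Fin 28 → ℝ) {ι : Type*} (s : Finset ι) (t : ι → ℝ)
    (g : ι → Fin 8 → ℝ) :
    ∑ k, w k * (phiForm (∑ j ∈ s, t j • g j) k / h28 a k) = ∑ j ∈ s, t j * ∑ k, w k * (phiForm (g j) k / h28 a k) := by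
  simp_rw [rate_sum_smul, Finset.mul_sum]
  rw [Finset.sum_comm]
  exact Finset.sum_congr rfl fun k _ => Finset.sum_congr rfl fun j _ => by ring

/-! ### The wall gauge is subadditive and positively homogeneous in the displacement -/

/-- **Positive homogeneity of the wall gauge**: for `t ≥ 0`,
`Σ_{ρ k<ρ l} Λ k l · max(r_k(t•δ) − r_l(t•δ), 0) = t · Σ_{ρ k<ρ l} Λ k l · max(r_k(δ) − r_l(δ), 0)`. -/
theorem wallGauge_smul (a : Dir) (ρ : Fin 28 → ℝ) (Λ : Fin 28 → Fin 28 → ℝ) (δ : Fin 8 → ℝ) {t : ℝ} (ht : 0 ≤ t) :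
    ∑ k, ∑ l, (if ρ k < ρ l then Λ k l * max (phiForm (t • δ) k / h28 a k - phiForm (t • δ) l / h28 a l) 0 else 0) =
      t * ∑ k, ∑ l, (if ρ k < ρ l then Λ k l * max (phiForm δ k / h28 a k - phiForm δ l / h28 a l) 0 else 0) := by
  rw [Finset.mul_sum]
  refine Finset.sum_congr rfl fun k _ => ?_
  rw [Finset.mul_sum]
  refine Finset.sum_congr rfl fun l _ => ?_
  by_cases h : ρ k < ρ l
  · rw [if_pos h, if_pos h, phiForm_smul, phiForm_smul, mul_div_assoc, mul_div_assoc, ← mul_sub,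
      ← mul_zero t, ← mul_max_of_nonneg _ _ ht, mul_zero]
    ring
  · rw [if_neg h, if_neg h, mul_zero]

/-- **Subadditivity of the wall gauge** (weights `≥ 0`):
`gauge(δ + δ') ≤ gauge(δ) + gauge(δ')` (`max(x + y, 0) ≤ max(x,0) + max(y,0)` wall by wall). -/
theorem wallGauge_add_le (a : Dir) (ρ : Fin 28 → ℝ) {Λ : Fin 28 → Fin 28 → ℝ} (hΛ : ∀ k l, 0 ≤ Λ k l)
    (δ δ' : Fin 8 → ℝ) :
    ∑ k, ∑ l, (if ρ k < ρ l then
        Λ k l * max (phiForm (δ + δ') k / h28 a k - phiForm (δ + δ') l / h28 a l) 0 else 0) ≤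
      ∑ k, ∑ l, (if ρ k < ρ l then Λ k l * max (phiForm δ k / h28 a k - phiForm δ l / h28 a l) 0 else 0) +
        ∑ k, ∑ l, (if ρ k < ρ l then Λ k l * max (phiForm δ' k / h28 a k - phiForm δ' l / h28 a l) 0 else 0) := by
  rw [← Finset.sum_add_distrib]
  refine Finset.sum_le_sum fun k _ => ?_
  rw [← Finset.sum_add_distrib]
  refine Finset.sum_le_sum fun l _ => ?_
  by_cases h : ρ k < ρ l
  · rw [if_pos h, if_pos h, if_pos h, ← mul_add]
    refine mul_le_mul_of_nonneg_left ?_ (hΛ k l)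
    rw [phiForm_add, phiForm_add, add_div, add_div]
    refine max_le ?_ (add_nonneg (le_max_right _ _) (le_max_right _ _))
    linarith [le_max_left (phiForm δ k / h28 a k - phiForm δ l / h28 a l) 0,
      le_max_left (phiForm δ' k / h28 a k - phiForm δ' l / h28 a l) 0]
  · rw [if_neg h, if_neg h, if_neg h, add_zero]

/-- **A subadditive, positively homogeneous functional is dominated on conic combinations**:
`Φ(Σ_{j∈s} t_j • g_j) ≤ Σ_{j∈s} t_j · Φ(g_j)` for `t ≥ 0` (pure). -/
theorem subadd_homog_sum_le (Φ : (Fin 8 → ℝ) → ℝ) (hadd : ∀ δ δ' : Fin 8 → ℝ, Φ (δ + δ') ≤ Φ δ + Φ δ')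
    (hsmul : ∀ (t : ℝ), 0 ≤ t → ∀ δ : Fin 8 → ℝ, Φ (t • δ) = t * Φ δ)
    {ι : Type*} (s : Finset ι) (t : ι → ℝ) (ht : ∀ j ∈ s, 0 ≤ t j) (g : ι → Fin 8 → ℝ) :
    Φ (∑ j ∈ s, t j • g j) ≤ ∑ j ∈ s, t j * Φ (g j) := by
  classical
  induction s using Finset.induction_on with
  | empty =>
    have h0 : Φ 0 = 0 := by
      have h := hsmul 0 le_rfl 0
      rwa [zero_smul, zero_mul] at h
    simp [h0]
  | insert j s hj ih =>
    rw [Finset.sum_insert hj, Finset.sum_insert hj]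
    have h1 := hadd (t j • g j) (∑ i ∈ s, t i • g i)
    have h2 := hsmul (t j) (ht j (Finset.mem_insert_self j s)) (g j)
    have h3 := ih fun i hi => ht i (Finset.mem_insert_of_mem hi)
    linarith

/-- **The wall gauge on a conic combination**: for weights `Λ ≥ 0` and `t ≥ 0`,
`gauge(Σ_j t_j • g_j) ≤ Σ_j t_j · gauge(g_j)`. -/
theorem wallGauge_sum_smul_le (a : Dir) (ρ : Fin 28 → ℝ) {Λ : Fin 28 → Fin 28 → ℝ} (hΛ : ∀ k l, 0 ≤ Λ k l)
    {ι : Type*} (s : Finset ι) (t : ι → ℝ) (ht : ∀ j ∈ s, 0 ≤ t j) (g : ι → Fin 8 → ℝ) :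
    ∑ k, ∑ l, (if ρ k < ρ l then Λ k l *
        max (phiForm (∑ j ∈ s, t j • g j) k / h28 a k - phiForm (∑ j ∈ s, t j • g j) l / h28 a l) 0 else 0) ≤
      ∑ j ∈ s, t j * ∑ k, ∑ l, (if ρ k < ρ l then
        Λ k l * max (phiForm (g j) k / h28 a k - phiForm (g j) l / h28 a l) 0 else 0) := by
  obtain ⟨Φ, hΦ⟩ : ∃ Φ : (Fin 8 → ℝ) → ℝ, ∀ δ, Φ δ = ∑ k, ∑ l, (if ρ k < ρ l then
      Λ k l * max (phiForm δ k / h28 a k - phiForm δ l / h28 a l) 0 else 0) := ⟨_, fun _ => rfl⟩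
  have h := subadd_homog_sum_le Φ (fun δ δ' => by rw [hΦ, hΦ, hΦ]; exact wallGauge_add_le a ρ hΛ δ δ')
    (fun t ht δ => by rw [hΦ, hΦ]; exact wallGauge_smul a ρ Λ δ ht) s t ht g
  simp only [hΦ] at h
  exact h

/-! ### No-ascent cones and ascent cones -/

/-- **A NO-ASCENT CONE FROM FINITELY MANY CHECKS.** With the data of `cuspSlope_le_greedy_add_wallGauge` (per-wall
bounds `Λ ≥ 0` dominating every defect of `F`, generic reference `δ₀`): if the majorant is `≤ 0` at finitely many
generators, `M⁺_{δ₀}(g_j) = G_{δ₀}(g_j) + Σ_{ρ₀ k<ρ₀ l} Λ k l · max(r_k(g_j) − r_l(g_j), 0) ≤ 0` for `j ∈ s`, then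
`cuspSlope a T (Σ_{j∈s} t_j • g_j) ≤ 0` for every `t ≥ 0` — no ascent direction in the polyhedral cone spanned by the
`g_j` (`σ ≤ M⁺`, `M⁺` subadditive and positively homogeneous). -/
theorem cuspSlope_nonpos_on_cone_of_generators {a : Dir} (hpos : ∀ k, 0 < h28 a k) {T : ℝ} (hT : 0 < T)
    (hper : ∀ k : Fin 28, ∃ z : ℤ, T * h28 a k = z)
    {M : ℕ → Finset (Fin 28)} {f : ℕ → Finset (Fin 28) → ℝ}
    (hf : ∀ m, m + 1 < (bkpts a T).card → ∀ Δ : Fin 8 → ℝ, (∀ k, |phiForm Δ k| < 1) →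
      (∀ k, |phiForm Δ k| < wallDist a T) →
        (torusN (bkpt a T m • sParam a + Δ) : ℝ) = f m ((M m).filter fun k => 0 ≤ phiForm Δ k))
    {F : Finset (Fin 28) → ℝ} (hF : ∀ A, F A = ∑ m ∈ Finset.range ((bkpts a T).card - 1), f m (A ∩ M m))
    {Λ : Fin 28 → Fin 28 → ℝ} (hΛ : ∀ k l, 0 ≤ Λ k l)
    (hdef : ∀ S : Finset (Fin 28), ∀ k l : Fin 28, k ∉ S → l ∉ S → k ≠ l →
      F (insert k S) + F (insert l S) - F S - F (insert k (insert l S)) ≤ Λ k l)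
    {δ₀ : Fin 8 → ℝ} (hgen : ∀ k l : Fin 28, k ≠ l → phiForm δ₀ k / h28 a k ≠ phiForm δ₀ l / h28 a l)
    {ι : Type*} (s : Finset ι) (g : ι → Fin 8 → ℝ)
    (hcert : ∀ j ∈ s,
      ∑ k, (F (Finset.univ.filter fun l => phiForm δ₀ k / h28 a k ≤ phiForm δ₀ l / h28 a l) -
          F (Finset.univ.filter fun l => phiForm δ₀ k / h28 a k < phiForm δ₀ l / h28 a l)) *
        (phiForm (g j) k / h28 a k) +
      ∑ k, ∑ l, (if phiForm δ₀ k / h28 a k < phiForm δ₀ l / h28 a l then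
        Λ k l * max (phiForm (g j) k / h28 a k - phiForm (g j) l / h28 a l) 0 else 0) ≤ 0)
    (t : ι → ℝ) (ht : ∀ j ∈ s, 0 ≤ t j) :
    cuspSlope a T (∑ j ∈ s, t j • g j) ≤ 0 := by
  have h1 := cuspSlope_le_greedy_add_wallGauge hpos hT hper hf hF hdef hgen (∑ j ∈ s, t j • g j)
  have h2 := wallGauge_sum_smul_le a (fun k => phiForm δ₀ k / h28 a k) hΛ s t ht g
  rw [greedyFun_sum_smul] at h1
  have h3 : ∑ j ∈ s, t j *
      ∑ k, (F (Finset.univ.filter fun l => phiForm δ₀ k / h28 a k ≤ phiForm δ₀ l / h28 a l) -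
          F (Finset.univ.filter fun l => phiForm δ₀ k / h28 a k < phiForm δ₀ l / h28 a l)) *
        (phiForm (g j) k / h28 a k) +
      ∑ j ∈ s, t j * ∑ k, ∑ l, (if phiForm δ₀ k / h28 a k < phiForm δ₀ l / h28 a l then
        Λ k l * max (phiForm (g j) k / h28 a k - phiForm (g j) l / h28 a l) 0 else 0) ≤ 0 := by
    rw [← Finset.sum_add_distrib]
    refine Finset.sum_nonpos fun j hj => ?_
    rw [← mul_add]
    exact mul_nonpos_of_nonneg_of_nonpos (ht j hj) (hcert j hj)
  linarith

/-- **AN ASCENT CONE FROM FINITELY MANY CHECKS.** With the data of `greedy_sub_wallGauge_le_cuspSlope` (per-wall bounds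
`Λ ≥ 0` with `−Λ ≤` every defect of `F`, generic reference `δ₀`): if the minorant is `> 0` at finitely many generators,
`M⁻_{δ₀}(g_j) = G_{δ₀}(g_j) − Σ_{ρ₀ k<ρ₀ l} Λ k l · max(r_k(g_j) − r_l(g_j), 0) > 0` for `j ∈ s`, then
`0 < cuspSlope a T (Σ_{j∈s} t_j • g_j)` for every `t ≥ 0` with some `t_j > 0` — every direction of the cone (minus
the apex) is an ascent direction. -/
theorem cuspSlope_pos_on_cone_of_generators {a : Dir} (hpos : ∀ k, 0 < h28 a k) {T : ℝ} (hT : 0 < T)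
    (hper : ∀ k : Fin 28, ∃ z : ℤ, T * h28 a k = z)
    {M : ℕ → Finset (Fin 28)} {f : ℕ → Finset (Fin 28) → ℝ}
    (hf : ∀ m, m + 1 < (bkpts a T).card → ∀ Δ : Fin 8 → ℝ, (∀ k, |phiForm Δ k| < 1) →
      (∀ k, |phiForm Δ k| < wallDist a T) →
        (torusN (bkpt a T m • sParam a + Δ) : ℝ) = f m ((M m).filter fun k => 0 ≤ phiForm Δ k))
    {F : Finset (Fin 28) → ℝ} (hF : ∀ A, F A = ∑ m ∈ Finset.range ((bkpts a T).card - 1), f m (A ∩ M m))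
    {Λ : Fin 28 → Fin 28 → ℝ} (hΛ : ∀ k l, 0 ≤ Λ k l)
    (hdef : ∀ S : Finset (Fin 28), ∀ k l : Fin 28, k ∉ S → l ∉ S → k ≠ l →
      -Λ k l ≤ F (insert k S) + F (insert l S) - F S - F (insert k (insert l S)))
    {δ₀ : Fin 8 → ℝ} (hgen : ∀ k l : Fin 28, k ≠ l → phiForm δ₀ k / h28 a k ≠ phiForm δ₀ l / h28 a l)
    {ι : Type*} (s : Finset ι) (g : ι → Fin 8 → ℝ)
    (hcert : ∀ j ∈ s, 0 <
      ∑ k, (F (Finset.univ.filter fun l => phiForm δ₀ k / h28 a k ≤ phiForm δ₀ l / h28 a l) -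
          F (Finset.univ.filter fun l => phiForm δ₀ k / h28 a k < phiForm δ₀ l / h28 a l)) *
        (phiForm (g j) k / h28 a k) -
      ∑ k, ∑ l, (if phiForm δ₀ k / h28 a k < phiForm δ₀ l / h28 a l then
        Λ k l * max (phiForm (g j) k / h28 a k - phiForm (g j) l / h28 a l) 0 else 0))
    (t : ι → ℝ) (ht : ∀ j ∈ s, 0 ≤ t j) (htpos : ∃ j ∈ s, 0 < t j) :
    0 < cuspSlope a T (∑ j ∈ s, t j • g j) := by
  have h1 := greedy_sub_wallGauge_le_cuspSlope hpos hT hper hf hF hdef hgen (∑ j ∈ s, t j • g j)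
  have h2 := wallGauge_sum_smul_le a (fun k => phiForm δ₀ k / h28 a k) hΛ s t ht g
  rw [greedyFun_sum_smul] at h1
  have h3 : 0 < ∑ j ∈ s, t j *
      ∑ k, (F (Finset.univ.filter fun l => phiForm δ₀ k / h28 a k ≤ phiForm δ₀ l / h28 a l) -
          F (Finset.univ.filter fun l => phiForm δ₀ k / h28 a k < phiForm δ₀ l / h28 a l)) *
        (phiForm (g j) k / h28 a k) -
      ∑ j ∈ s, t j * ∑ k, ∑ l, (if phiForm δ₀ k / h28 a k < phiForm δ₀ l / h28 a l then
        Λ k l * max (phiForm (g j) k / h28 a k - phiForm (g j) l / h28 a l) 0 else 0) := by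
    rw [← Finset.sum_sub_distrib]
    obtain ⟨j₀, hj₀, htj₀⟩ := htpos
    refine Finset.sum_pos' (fun j hj => ?_) ⟨j₀, hj₀, ?_⟩
    · rw [← mul_sub]; exact mul_nonneg (ht j hj) (hcert j hj).le
    · rw [← mul_sub]; exact mul_pos htj₀ (hcert j₀ hj₀)
  linarith

/-! ### Covering: «σ ≤ 0 in every direction» from finitely many cones -/

/-- **THE CONE-COVERING CERTIFICATE (any type).** With the data of `cuspSlope_le_greedy_add_wallGauge` (per-wall bounds
`Λ ≥ 0`): a family of generic references `δ₀ c` with generator families `g c j` (`j ∈ s c`), each certified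
(`M⁺_{δ₀ c}(g c j) ≤ 0`), whose cones COVER the displacements (`hcover`: every `δ` is a conic combination of some
family) gives `cuspSlope a T δ ≤ 0` for EVERY `δ`. (A finite `κ` makes this a finite rational certificate; no
instance is asserted here — at the cell's four named directions ascent directions exist, DATA.) -/
theorem cuspSlope_nonpos_of_cone_covering {a : Dir} (hpos : ∀ k, 0 < h28 a k) {T : ℝ} (hT : 0 < T)
    (hper : ∀ k : Fin 28, ∃ z : ℤ, T * h28 a k = z)
    {M : ℕ → Finset (Fin 28)} {f : ℕ → Finset (Fin 28) → ℝ}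
    (hf : ∀ m, m + 1 < (bkpts a T).card → ∀ Δ : Fin 8 → ℝ, (∀ k, |phiForm Δ k| < 1) →
      (∀ k, |phiForm Δ k| < wallDist a T) →
        (torusN (bkpt a T m • sParam a + Δ) : ℝ) = f m ((M m).filter fun k => 0 ≤ phiForm Δ k))
    {F : Finset (Fin 28) → ℝ} (hF : ∀ A, F A = ∑ m ∈ Finset.range ((bkpts a T).card - 1), f m (A ∩ M m))
    {Λ : Fin 28 → Fin 28 → ℝ} (hΛ : ∀ k l, 0 ≤ Λ k l)
    (hdef : ∀ S : Finset (Fin 28), ∀ k l : Fin 28, k ∉ S → l ∉ S → k ≠ l →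
      F (insert k S) + F (insert l S) - F S - F (insert k (insert l S)) ≤ Λ k l)
    {κ ι : Type*} (δ₀ : κ → Fin 8 → ℝ)
    (hgen : ∀ c, ∀ k l : Fin 28, k ≠ l → phiForm (δ₀ c) k / h28 a k ≠ phiForm (δ₀ c) l / h28 a l)
    (s : κ → Finset ι) (g : κ → ι → Fin 8 → ℝ)
    (hcert : ∀ c, ∀ j ∈ s c,
      ∑ k, (F (Finset.univ.filter fun l => phiForm (δ₀ c) k / h28 a k ≤ phiForm (δ₀ c) l / h28 a l) -
          F (Finset.univ.filter fun l => phiForm (δ₀ c) k / h28 a k < phiForm (δ₀ c) l / h28 a l)) *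
        (phiForm (g c j) k / h28 a k) +
      ∑ k, ∑ l, (if phiForm (δ₀ c) k / h28 a k < phiForm (δ₀ c) l / h28 a l then
        Λ k l * max (phiForm (g c j) k / h28 a k - phiForm (g c j) l / h28 a l) 0 else 0) ≤ 0)
    (hcover : ∀ δ : Fin 8 → ℝ, ∃ c, ∃ t : ι → ℝ, (∀ j ∈ s c, 0 ≤ t j) ∧ δ = ∑ j ∈ s c, t j • g c j)
    (δ : Fin 8 → ℝ) : cuspSlope a T δ ≤ 0 := by
  obtain ⟨c, t, ht, rfl⟩ := hcover δ
  exact cuspSlope_nonpos_on_cone_of_generators hpos hT hper hf hF hΛ hdef (hgen c) (s c) (g c) (hcert c) t ht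

/-! ### The certificates live on `ℝ⁸ / ℝ·s(a)` -/

/-- **The majorant is invariant under the radial displacement**: `M⁺_{δ₀}(δ + u • s(a)) = M⁺_{δ₀}(δ)` for every real `u`
— all 28 rates shift by `u` (`φ_k(u•s(a)) = u·h_k(a)`), the gauge only sees rate differences, and the chamber weights sum
to zero (P2 g31's `period_greedy_sum_eq_zero`). So a cone certificate is a statement about directions modulo `s(a)`. -/
theorem majorant_add_smul_sParam {a : Dir} (hpos : ∀ k, 0 < h28 a k) {T : ℝ} (hT : 0 < T)
    (hper : ∀ k : Fin 28, ∃ z : ℤ, T * h28 a k = z)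
    {M : ℕ → Finset (Fin 28)} {f : ℕ → Finset (Fin 28) → ℝ}
    (hf : ∀ m, m + 1 < (bkpts a T).card → ∀ Δ : Fin 8 → ℝ, (∀ k, |phiForm Δ k| < 1) →
      (∀ k, |phiForm Δ k| < wallDist a T) →
        (torusN (bkpt a T m • sParam a + Δ) : ℝ) = f m ((M m).filter fun k => 0 ≤ phiForm Δ k))
    {F : Finset (Fin 28) → ℝ} (hF : ∀ A, F A = ∑ m ∈ Finset.range ((bkpts a T).card - 1), f m (A ∩ M m))
    (Λ : Fin 28 → Fin 28 → ℝ)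
    {δ₀ : Fin 8 → ℝ} (hgen : ∀ k l : Fin 28, k ≠ l → phiForm δ₀ k / h28 a k ≠ phiForm δ₀ l / h28 a l)
    (δ : Fin 8 → ℝ) (u : ℝ) :
    ∑ k, (F (Finset.univ.filter fun l => phiForm δ₀ k / h28 a k ≤ phiForm δ₀ l / h28 a l) -
          F (Finset.univ.filter fun l => phiForm δ₀ k / h28 a k < phiForm δ₀ l / h28 a l)) *
        (phiForm (δ + u • sParam a) k / h28 a k) +
      ∑ k, ∑ l, (if phiForm δ₀ k / h28 a k < phiForm δ₀ l / h28 a l then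
        Λ k l * max (phiForm (δ + u • sParam a) k / h28 a k - phiForm (δ + u • sParam a) l / h28 a l) 0
        else 0) =
    ∑ k, (F (Finset.univ.filter fun l => phiForm δ₀ k / h28 a k ≤ phiForm δ₀ l / h28 a l) -
          F (Finset.univ.filter fun l => phiForm δ₀ k / h28 a k < phiForm δ₀ l / h28 a l)) *
        (phiForm δ k / h28 a k) +
      ∑ k, ∑ l, (if phiForm δ₀ k / h28 a k < phiForm δ₀ l / h28 a l then
        Λ k l * max (phiForm δ k / h28 a k - phiForm δ l / h28 a l) 0 else 0) := by
  have hrate : ∀ k, phiForm (δ + u • sParam a) k / h28 a k = phiForm δ k / h28 a k + u := fun k => by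
    rw [phiForm_add, phiForm_smul_sParam, add_div, mul_div_assoc, div_self (hpos k).ne', mul_one]
  simp only [hrate]
  have hW := period_greedy_sum_eq_zero hpos hT hper hf hF hgen
  congr 1
  · have e : ∑ k, (F (Finset.univ.filter fun l => phiForm δ₀ k / h28 a k ≤ phiForm δ₀ l / h28 a l) -
          F (Finset.univ.filter fun l => phiForm δ₀ k / h28 a k < phiForm δ₀ l / h28 a l)) *
        (phiForm δ k / h28 a k + u) =
      ∑ k, (F (Finset.univ.filter fun l => phiForm δ₀ k / h28 a k ≤ phiForm δ₀ l / h28 a l) -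
          F (Finset.univ.filter fun l => phiForm δ₀ k / h28 a k < phiForm δ₀ l / h28 a l)) *
        (phiForm δ k / h28 a k) +
      u * ∑ k, (F (Finset.univ.filter fun l => phiForm δ₀ k / h28 a k ≤ phiForm δ₀ l / h28 a l) -
          F (Finset.univ.filter fun l => phiForm δ₀ k / h28 a k < phiForm δ₀ l / h28 a l)) := by
      rw [Finset.mul_sum, ← Finset.sum_add_distrib]
      exact Finset.sum_congr rfl fun k _ => by ring
    rw [e, hW, mul_zero, add_zero]
  · refine Finset.sum_congr rfl fun k _ => Finset.sum_congr rfl fun l _ => ?_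
    rw [add_sub_add_right_eq_sub]

end Summit.KontsevichZagierPeriods.Zeta5Search.Barrier.ConeGamma

end
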